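import Mathlib
import Literature.Analysis.FunctionSpaces.TorusFluidGlue
import Literature.Analysis.FluidPDE.PassiveScalar
import HarnessLib

/-!
# Seis (2022): diffusion-limited bounds on the rate of enhanced dissipation

Named facts (Literature is sorry-free; users take `(h : Seis2022_thm2_L2)` /
`(h : Seis2022_rmk1_L2)`).

Source: C. Seis, *Bounds on the rate of enhanced dissipation*, Comm. Math. Phys. **399** (2023),
2071–2081 = arXiv:2003.08794 (arXiv title: *Diffusion limited mixing rates in passive scalar
advection*) [cite: Seis2022]. Setting (p. 2): the advection–diffusion equation
`∂ₜθ^κ + u·∇θ^κ = κΔθ^κ` on the periodic box `T^d`, `u` divergence-free in the class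
`L^s(ℝ₊; W^{1,p}(T^d))` normalised by `‖∇u‖_{L^s_t L^p_x} ≤ 1`, mean-zero datum `θ₀ ∈ L^q`,
`1/p + 1/q ≤ 1` ("in order to ensure the well-posedness of distributional solutions",
DiPerna–Lions); notation (p. 2, footnote): `A ≲ B` iff `A ≤ C B` for a uniform constant `C`
independent of `κ`, `A ∼ B` iff both, and `κ ≪ 1` throughout.

* **Theorem 2** (pp. 3–4, verbatim): *Suppose that `u ∈ L^s(ℝ₊; W^{1,p}(T^d))` for some
  `p ∈ (1,∞]` and `s ∈ [1,∞]`, satisfying `‖∇u‖_{L^s_t L^p_x} ≤ 1`. Let `q ∈ [1,∞]` be such that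
  `1/p + 1/q ≤ 1` and let `r ∈ [1,∞]` be such that `r ≥ q` if `1/p + 1/q = 1`. Let `θ₀` be a
  mean-zero initial configuration satisfying `‖θ₀‖_{L¹} ∼ 1` and `‖∇θ₀‖_{L¹} ∼ 1`. If there is a
  positive constant `D` such that `‖θ^κ(t)‖_{L^r} ≲ e^{-Dt}` for any `t > 0`, then
  `D ≲ log^{-s/(s-1)}(1/κ)` if `s > 1`, and `D ≲ κ` if `s = 1`.*
* **Remark 1** (p. 4, verbatim): *By a small variation of its proof for the `s = ∞` case, the
  statement in Theorem 2 can be extended to velocity fields with gradient bounds of the type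
  `∫₀ᵗ ‖∇u‖_{L²} dt ≲ 1 + t`.* (The variation: in the proof, §2.2 p. 8, the sum
  `∑ₙ e^{-n} ∫_{tⁿ}^{tⁿ⁺¹} ‖∇u‖ dt` with `tⁿ = n/D` is bounded by `∑ₙ e^{-n}(1 + (n+1)/D) ≲ 1 + 1/D`
  instead of Hölder.)

Rendering (both facts are the case `p = q = r = 2`, `s = ∞` of the enstrophy-type budget, the one
relevant to Navier–Stokes stirring; `s/(s-1) = 1`):
* the implicit constants are unwound as the proof (§2.2, from Lemma 3 [OttoSeisSlepcev13, Seis18]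
  and the interpolation Lemma 4) gives them: the bound reads `D ≤ K / log(1/κ)` for all
  `κ ∈ (0, κ₀]`, where `κ₀ ∈ (0,1)` ("`κ ≪ 1`") and `K` depend only on `d` and on the displayed
  normalisation constants — a lower bound `a` on `‖θ₀‖_{L¹}`, upper bounds `b` on `‖θ₀‖_{L¹}` and
  `B` on `‖∇θ₀‖_{L¹}`, the prefactor `C₀` of the decay hypothesis (and, for Remark 1, the budget
  constant `M`); they do not depend on `u`, `θ₀`, `θ`, `κ` or `D` otherwise. The printed lower
  bound in `‖∇θ₀‖_{L¹} ∼ 1` is implied by `a ≤ ‖θ₀‖_{L¹}` and the mean-zero condition (Poincaré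
  in `W^{1,1}(T^d)`), so it is not repeated;
* the datum is taken smooth (`Torus.IsSmooth`, in particular `W^{1,1} ∩ L²` as in print), with
  `‖∇θ₀‖_{L¹} = ∫ ‖Torus.gradient θ₀‖`;
* `u ∈ L^∞(ℝ₊; W^{1,2})` is rendered as `u ∈ L^∞_t L²_x` plus the spectral gradient bound
  `Torus.eGradNormSq (u t) ≤ 1` for a.e. `t > 0` (`= ‖∇u(t)‖²_{L²}`, so this is `‖∇u‖ ≤ 1`);
  incompressibility is part of the solution notion;
* "`θ^κ`, the solution" is rendered as every weak solution in the tree's class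
  `Torus.IsWeakScalarTransportOn T κ u θ₀ θ` (DiPerna–Lions weak solutions on `[0,T)`,
  `θ ∈ L^∞_t L²_x`) for every `T > 0` — with `p = q = 2` this is exactly the well-posedness class
  the paper works in (p. 2), so nothing is added;
* the decay hypothesis and its rate are stated in squared form with `Torus.scalarL2Sq` and for
  a.e. `t > 0` (weak solutions are a.e.-defined in time; modifying `θ` on a null set of times
  gives a weak solution with the bound for every `t`, so this is the printed hypothesis).

Scaling note for users: for a budget `‖∇u‖ ≤ G` apply the fact to `t ↦ θ(t/G)`, velocity `u/G`,
diffusivity `κ/G`: a rate `D` becomes `D/G ≤ K / log(G/κ)`.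

Bears on route `LimitingAbsorption` of `AnomalousDissipation`: it is the obstruction-side fact
quantifying the why-might-fail of
`Summit.AnomalousDissipation.AnomalousDissipation.Theses.LimitingAbsorption.UniformRelaxationWitness`
(stmt-AnomalousDissipation-2937: a `ν`-uniform relaxation rate `γ` of the profile `h` forces
time-averaged planar enstrophy `≳ γ² log²(1/ν_j)`), and grounds the bounded-enstrophy (e.g.
single-shell forcing, Alexakis–Doering 2006 §4) case of
`Summit.AnomalousDissipation.AnomalousDissipation.Theses.LimitingAbsorption.NoUniformRelaxation`
(stmt-AnomalousDissipation-2939) = Remark 1 ∘ (time-averaged enstrophy bound) after the time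
rescaling above.
-/

namespace Literature.Analysis.FluidPDE

open _root_.MeasureTheory _root_.Set
open scoped NNReal ENNReal

/-- **Seis 2022, Theorem 2, case `p = q = r = 2`, `s = ∞`** (arXiv:2003.08794 pp. 3–4; CMP 399).
For every dimension (index type `d`) and normalisation constants `a > 0`, `b`, `B`, `C₀ > 0` there
are `κ₀ ∈ (0,1)` and `K ≥ 0` such that: for all `κ ∈ (0, κ₀]`, every velocity field
`u ∈ L^∞(ℝ₊; W^{1,2}(T^d; ℝ^d))` (ess-bounded `‖u(t)‖_{L²}`, `‖∇u(t)‖²_{L²} = eGradNormSq (u t) ≤ 1`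
for a.e. `t > 0`; divergence-free through the solution notion), every smooth mean-zero datum
`θ₀` with `a ≤ ‖θ₀‖_{L¹} ≤ b` and `‖∇θ₀‖_{L¹} ≤ B`, every weak solution `θ` of
`∂ₜθ + u·∇θ = κΔθ`, `θ(0) = θ₀` on `[0,T)` for all `T > 0`, and every rate `D`:
if `‖θ(t)‖_{L²} ≤ C₀ e^{-Dt}` for a.e. `t > 0`, then `D ≤ K / log(1/κ)` — exponential
dissipation rates of scalars stirred under an enstrophy constraint decay at least like
`1/log(1/κ)` as `κ → 0`. [cite: Seis2022, Thm 2 (pp. 3–4), proof §2.2 (pp. 7–8)] -/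
def Seis2022_thm2_L2 : Prop :=
  ∀ {d : Type} [Fintype d] [DecidableEq d] (a b B C₀ : ℝ), 0 < a → 0 < C₀ →
    ∃ κ₀ K : ℝ, 0 < κ₀ ∧ κ₀ < 1 ∧ 0 ≤ K ∧
      ∀ (κ D : ℝ) (u : ℝ → UnitAddTorus d → EuclideanSpace ℝ d) (θ₀ : UnitAddTorus d → ℝ)
        (θ : ℝ → UnitAddTorus d → ℝ),
        0 < κ → κ ≤ κ₀ →
        (∃ M : ℝ≥0, ∀ᵐ t ∂(volume.restrict (Ioi (0 : ℝ))), ∫⁻ x, ‖u t x‖ₑ ^ 2 ≤ M) →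
        (∀ᵐ t ∂(volume.restrict (Ioi (0 : ℝ))), FunctionSpaces.Torus.eGradNormSq (u t) ≤ 1) →
        FunctionSpaces.Torus.IsSmooth θ₀ → FunctionSpaces.Torus.HasZeroMean θ₀ →
        a ≤ ∫ x, |θ₀ x| → ∫ x, |θ₀ x| ≤ b →
        ∫ x, ‖FunctionSpaces.Torus.gradient θ₀ x‖ ≤ B →
        (∀ T : ℝ, 0 < T → Torus.IsWeakScalarTransportOn T κ u θ₀ θ) →
        (∀ᵐ t ∂(volume.restrict (Ioi (0 : ℝ))),
            Torus.scalarL2Sq (θ t) ≤ (C₀ * Real.exp (-(D * t))) ^ 2) →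
        D ≤ K / Real.log κ⁻¹

/-- **Seis 2022, Remark 1 (time-averaged enstrophy budget), case `p = q = r = 2`**
(arXiv:2003.08794 p. 4: "by a small variation of its proof for the `s = ∞` case, the statement in
Theorem 2 can be extended to velocity fields with gradient bounds of the type
`∫₀ᵗ ‖∇u‖_{L²} dt ≲ 1 + t`"). For every dimension and constants `a > 0`, `b`, `B`, `C₀ > 0`,
`M ≥ 0` there are `κ₀ ∈ (0,1)` and `K ≥ 0` such that: for all `κ ∈ (0, κ₀]`, every velocity
field `u ∈ L^∞(ℝ₊; L²)` with `∫₀ᵗ ‖∇u(τ)‖_{L²} dτ ≤ M (1 + t)` for all `t > 0`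
(`‖∇u(τ)‖_{L²} = (eGradNormSq (u τ))^{1/2}`, lower Lebesgue integral in time), every smooth
mean-zero datum `θ₀` with `a ≤ ‖θ₀‖_{L¹} ≤ b`, `‖∇θ₀‖_{L¹} ≤ B`, every weak solution `θ` of
`∂ₜθ + u·∇θ = κΔθ`, `θ(0) = θ₀` on `[0,T)` for all `T > 0`, and every rate `D`:
if `‖θ(t)‖_{L²} ≤ C₀ e^{-Dt}` for a.e. `t > 0`, then `D ≤ K / log(1/κ)`. A printed Remark
(extension of Theorem 2 asserted with the indicated one-line change in the proof, §2.2 p. 8), vendored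
as such. [cite: Seis2022, Remark 1 (p. 4); Thm 2] -/
def Seis2022_rmk1_L2 : Prop :=
  ∀ {d : Type} [Fintype d] [DecidableEq d] (a b B C₀ M : ℝ), 0 < a → 0 < C₀ → 0 ≤ M →
    ∃ κ₀ K : ℝ, 0 < κ₀ ∧ κ₀ < 1 ∧ 0 ≤ K ∧
      ∀ (κ D : ℝ) (u : ℝ → UnitAddTorus d → EuclideanSpace ℝ d) (θ₀ : UnitAddTorus d → ℝ)
        (θ : ℝ → UnitAddTorus d → ℝ),
        0 < κ → κ ≤ κ₀ →
        (∃ M' : ℝ≥0, ∀ᵐ t ∂(volume.restrict (Ioi (0 : ℝ))), ∫⁻ x, ‖u t x‖ₑ ^ 2 ≤ M') →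
        (∀ t : ℝ, 0 < t →
            ∫⁻ τ in Ioo 0 t, FunctionSpaces.Torus.eGradNormSq (u τ) ^ (1 / 2 : ℝ) ≤
              ENNReal.ofReal (M * (1 + t))) →
        FunctionSpaces.Torus.IsSmooth θ₀ → FunctionSpaces.Torus.HasZeroMean θ₀ →
        a ≤ ∫ x, |θ₀ x| → ∫ x, |θ₀ x| ≤ b →
        ∫ x, ‖FunctionSpaces.Torus.gradient θ₀ x‖ ≤ B →
        (∀ T : ℝ, 0 < T → Torus.IsWeakScalarTransportOn T κ u θ₀ θ) →
        (∀ᵐ t ∂(volume.restrict (Ioi (0 : ℝ))),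
            Torus.scalarL2Sq (θ t) ≤ (C₀ * Real.exp (-(D * t))) ^ 2) →
        D ≤ K / Real.log κ⁻¹

#harness_tags Seis2022_thm2_L2
#harness_tags Seis2022_rmk1_L2

end Literature.Analysis.FluidPDE
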